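import Summits.BirchSwinnertonDyer.BirchSwinnertonDyer.Theorems.ByReductionTypeAtTwoMultUpperHalfTowerTorsion
import HarnessLib

/-!
# Route `ByReductionTypeAtTwo`, crux `MultUpperHalfAtTwo` (item stmt-BirchSwinnertonDyer-19922): the TOWER road WITH RATIONAL
# `2`-TORSION — part 2: the NUMERIC / rational-prime / decidable-CERT layers with the constant at `2` a DATUM `C₂`
# (GEN 4's `MultTowerCert.towerGapAtTwo_of_layerSelmer_{numeric,nat,cert}_atTwo`, torsion-tolerant twins)

HONEST FRAMING (cell `bsd-2adic`, run/shared/lean/pub/bsd-2adic/, seat `bsd-2adic-mult-2` GEN 5, HUMAN RULING D-0074 row (A)):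
research route; THEOREMS ONLY (no definition, no new named fact); nothing is booked; BSD is not proved by any of this.
PARTITION: X5@2 mult (K4ᵐ, RESIDUAL-MAP B1·O1; 1 976 book230 classes) × p = 2 — types-the-object-of (the per-class certificate
format of the TOWER road on the 142 «neither» rank-`0` classes of the residual of the line `four_roads` — rational `2`-torsion
at every member); closes none. bears_on: K4 (route-BirchSwinnertonDyer-ByReductionTypeAtTwo item 19922).

WHAT. Part 1 (`…MultUpperHalfTowerTorsion.lean`) proved the torsion-tolerant GAP door in tower-1's place currency
(`MultTowerTorsion.towerGapAtTwo_of_localKernelBounds{,_sharp}_of_torsion`: `htors` replaced by the finiteness of `E(ℚ_∞)[2^∞]`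
(`hB`) and a torsion count `#E[2^∞]^{Gal(ℚ̄/ℚ_j)} ≤ 2^t`, arithmetic with `2^{d+t}`). This file carries GEN 4's three
bookkeeping layers over it VERBATIM (seat mult-2 GEN 4, `…MultUpperHalfTowerCert.lean` §1, p444347): numeric local constants at
the odd places justified by one PRINT disjunct each (`h33g`/`hM`/`hA`, tower-1 `pTorsion_localTowerKer_le_of_numeric`), then
rational-prime indexing (`P ⊇` odd primes of `Δ_min`), then every kernel-side datum decidable (`e`, `k` certificates). Nothing
else changes; the constant at `2` stays a displayed datum `h2` (non-split `4` / split `2^{k_q}` are plugged in by part 3).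

WHAT IS DISPLAYED, NOT PROVED: PRINT {`h33g`, `hM`, `hA`}, the datum `h2`, the finiteness `hB`; CERTIFICATES {`hlow`, `hup`,
`htor`, `P`, `C`, `e`, `k`, arithmetic}. ∀-LEVEL CONTENT: none.

References: R. Greenberg, LNM 1716 (1999), §1 pp. 60–62, §3 pp. 85–94, §4 Lemma 4.3; L. Washington, *Introduction to
Cyclotomic Fields*, §13.1–13.2; J. Silverman, AEC, VII.1 Prop. 1.3, VII.5.1.
-/

set_option autoImplicit false
-- the Theorems namespace of this sub repeats the summit name by design (D-0017 nested layout: Summit.<S>.<Sub>)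
set_option linter.dupNamespace false

noncomputable section

open scoped Classical MatrixGroups ModularForm

open NumberField IsDedekindDomain CongruenceSubgroup WeierstrassCurve Literature.NumberTheory.EllipticCurves
  Literature.NumberTheory.EllipticCurves.ModularForms
  Literature.NumberTheory.EllipticCurves.Greenberg1999
  Literature.NumberTheory.EllipticCurves.Rank1Residual
  Literature.NumberTheory.EllipticCurves.Rank1Residual.Typed
  Literature.NumberTheory.GaloisRepresentations
  Summit.BirchSwinnertonDyer.Rank1Residual.X5 Summit.BirchSwinnertonDyer.Rank1Residual.X5.O1
  Summit.BirchSwinnertonDyer.Rank1Residual.X5.TowerGap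
  Summit.BirchSwinnertonDyer.Rank1Residual
  Summit.BirchSwinnertonDyer.BirchSwinnertonDyer.Theorems.KatoHalfPinch
  Rat.HeightOneSpectrum

namespace Summit.BirchSwinnertonDyer.BirchSwinnertonDyer.Theorems.MultTowerTorsion

/-! ## §2 The numeric / rational-prime / decidable-CERT layers (torsion-tolerant twins of GEN 4's `MultTowerCert` §1) -/

section Cert

variable (W : WeierstrassCurve ℚ) [W.IsElliptic] [W.IsGloballyMinimal]

omit [W.IsGloballyMinimal] in
/-- **The GAP certificate with NUMERIC local constants, the constant at `2` a DATUM, RATIONAL `2`-TORSION ALLOWED.** `W/ℚ`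
elliptic (ANY reduction type at `2`, any torsion; `hB` the finiteness of `E(ℚ_∞)[2^∞]`, `htor` the torsion count at layer `j`); layers `j ≤ j'`; `S` a finite set of finite places off which every
place is odd and good (`hS`); PRINT `h33g`, `hM`, `hA` (Greenberg L.3.3 + p. 88 readings, every layer); a displayed
bound `h2` on `#𝒦_{v,j'}[2]` at the place(s) over `2` by `C₂`; numeric constants `C_v` at the odd `v ∈ S` justified by
ONE disjunct of `hC`; layer counts `hlow`/`hup`; arithmetic
`2^d · ∏_{v ∈ S} (2 ∈ v ? C₂ : C_v)^{(2 ∈ v ? 1 : 2^{min(j', v₂(ℓ_v² − 1) − 3)})} < 2^{2^{j'} − 2^j + a}`. Then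
`O1.TowerGapAtTwo W` (§1's `towerGapAtTwo_of_localKernelBounds_sharp_of_torsion`; GEN 4's `MultTowerCert.…_numeric_atTwo` verbatim otherwise).
[cite: GreenbergLNM1716, §3 Lemmas 3.3–3.5 (PDF pp. 86–90) and pp. 90–93] [cite: Washington1997, §13.1] -/
theorem towerGapAtTwo_of_layerSelmer_numeric_atTwo_of_torsion
    (h33g : lemma33_localTowerKerPrimary_eq_bot_of_good.{0})
    (hM : lemma33_localTowerKerPrimary_cyclic_of_multiplicative.{0})
    (hA : lemma33_natCard_localTowerKerPrimary_le_four_of_additive.{0})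
    (hB : ∀ κ : ZpExtension ℚ 2, κ.IsCyclotomic →
      Finite (FixedPoints.addSubgroup κ.kerSubgroup (geomPrimaryTorsion W 2)))
    {j j' a d t : ℕ} (hjj' : j ≤ j')
    (htor : ∀ κ : ZpExtension ℚ 2, κ.IsCyclotomic →
      Nat.card {m : geomPrimaryTorsion W 2 | ∀ σ ∈ κ.layerSubgroup j, σ • m = m} ≤ 2 ^ t) (C₂ : ℕ)
    (h2 : ∀ κ : ZpExtension ℚ 2, κ.IsCyclotomic → ∀ v : HeightOneSpectrum (𝓞 ℚ),
      ((2 : ℕ) : 𝓞 ℚ) ∈ v.asIdeal →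
        Finite {x : W.localTowerKerPrimary κ (v.adicCompletion ℚ) j' // 2 • x = 0} ∧
          Nat.card {x : W.localTowerKerPrimary κ (v.adicCompletion ℚ) j' // 2 • x = 0} ≤ C₂)
    (S : Finset (HeightOneSpectrum (𝓞 ℚ)))
    (hS : ∀ v ∉ S, ((2 : ℕ) : 𝓞 ℚ) ∉ v.asIdeal ∧ W.HasGoodReductionAt v)
    (C : HeightOneSpectrum (𝓞 ℚ) → ℕ)
    (hC : ∀ v ∈ S, ((2 : ℕ) : 𝓞 ℚ) ∉ v.asIdeal →
      4 ≤ C v ∨ (W.HasMultiplicativeReductionAt v ∧ 2 ≤ C v) ∨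
        (W.HasMultiplicativeReductionAt v ∧ ¬ 2 ∣ W.ordMinimalDiscriminant v ∧ 1 ≤ C v) ∨
        (W.HasGoodReductionAt v ∧ 1 ≤ C v))
    (hlow : ∀ κ : ZpExtension ℚ 2, κ.IsCyclotomic →
      2 ^ a ≤ Nat.card {z : W.selmerLayer κ j // 2 • z = 0})
    (hup : ∀ κ : ZpExtension ℚ 2, κ.IsCyclotomic →
      Nat.card {z : W.selmerLayer κ j' // 2 • z = 0} ≤ 2 ^ d)
    (harith : 2 ^ (d + t) * ∏ v ∈ S, (if ((2 : ℕ) : 𝓞 ℚ) ∈ v.asIdeal then C₂ else C v) ^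
        (if ((2 : ℕ) : 𝓞 ℚ) ∈ v.asIdeal then 1
          else 2 ^ min j' (padicValNat 2 (natGenerator v ^ 2 - 1) - 3)) <
      2 ^ (2 ^ j' - 2 ^ j + a)) : TowerGapAtTwo W := by
  refine towerGapAtTwo_of_localKernelBounds_sharp_of_torsion W hB hjj' S
    (fun v ↦ if ((2 : ℕ) : 𝓞 ℚ) ∈ v.asIdeal then C₂ else C v) hlow htor hup
    (fun κ hκ v hv ↦ h33g ℚ W 2 κ hκ v (hS v hv).1 (hS v hv).2 j') (fun κ hκ v hv ↦ ?_) harith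
  by_cases h2v : ((2 : ℕ) : 𝓞 ℚ) ∈ v.asIdeal
  · rw [if_pos h2v]
    exact h2 κ hκ v h2v
  · rw [if_neg h2v]
    exact pTorsion_localTowerKer_le_of_numeric W h33g hM hA κ hκ v h2v j' (C v) (hC v hv h2v)

/-- **The GAP certificate indexed by rational primes, the constant at `2` a DATUM, RATIONAL `2`-TORSION ALLOWED.** As GEN 4's
`MultTowerCert.towerGapAtTwo_of_layerSelmer_nat_atTwo` with `htors` replaced by {`hB`, `htor`} and `2^d` by `2^{d+t}`: `P` a finite set of ODD primes containing every odd prime of the minimal discriminant, `C : ℕ → ℕ` justified per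
`ℓ ∈ P` by one disjunct, arithmetic `2^d · C₂ · ∏_{ℓ ∈ P} C_ℓ^{2^{min(j', v₂(ℓ² − 1) − 3)}} < 2^{2^{j'} − 2^j + a}`.
[cite: GreenbergLNM1716, §3 Lemmas 3.3–3.5 (PDF pp. 86–90) and pp. 90–93] [cite: SilvermanAEC2009, VII.1 Prop. 1.3, VII.5.1] -/
theorem towerGapAtTwo_of_layerSelmer_nat_atTwo_of_torsion
    (h33g : lemma33_localTowerKerPrimary_eq_bot_of_good.{0})
    (hM : lemma33_localTowerKerPrimary_cyclic_of_multiplicative.{0})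
    (hA : lemma33_natCard_localTowerKerPrimary_le_four_of_additive.{0})
    (hB : ∀ κ : ZpExtension ℚ 2, κ.IsCyclotomic →
      Finite (FixedPoints.addSubgroup κ.kerSubgroup (geomPrimaryTorsion W 2)))
    {j j' a d t : ℕ} (hjj' : j ≤ j')
    (htor : ∀ κ : ZpExtension ℚ 2, κ.IsCyclotomic →
      Nat.card {m : geomPrimaryTorsion W 2 | ∀ σ ∈ κ.layerSubgroup j, σ • m = m} ≤ 2 ^ t) (C₂ : ℕ)
    (h2 : ∀ κ : ZpExtension ℚ 2, κ.IsCyclotomic → ∀ v : HeightOneSpectrum (𝓞 ℚ),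
      ((2 : ℕ) : 𝓞 ℚ) ∈ v.asIdeal →
        Finite {x : W.localTowerKerPrimary κ (v.adicCompletion ℚ) j' // 2 • x = 0} ∧
          Nat.card {x : W.localTowerKerPrimary κ (v.adicCompletion ℚ) j' // 2 • x = 0} ≤ C₂)
    (P : Finset ℕ) (hP : ∀ ℓ ∈ P, ℓ.Prime ∧ ℓ ≠ 2)
    (hΔ : ∀ ℓ : ℕ, ℓ.Prime → ℓ ≠ 2 → (ℓ : ℤ) ∣ W.minimalDiscriminantInt → ℓ ∈ P)
    (C : ℕ → ℕ)
    (hC : ∀ (ℓ : ℕ) [Fact ℓ.Prime], ℓ ∈ P →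
      4 ≤ C ℓ ∨ (W.HasMultiplicativeReductionAtPrime ℓ ∧ 2 ≤ C ℓ) ∨
        (W.HasMultiplicativeReductionAtPrime ℓ ∧ ¬ 2 ∣ padicValInt ℓ W.minimalDiscriminantInt ∧
          1 ≤ C ℓ) ∨
        (¬ (ℓ : ℤ) ∣ W.minimalDiscriminantInt ∧ 1 ≤ C ℓ))
    (hlow : ∀ κ : ZpExtension ℚ 2, κ.IsCyclotomic →
      2 ^ a ≤ Nat.card {z : W.selmerLayer κ j // 2 • z = 0})
    (hup : ∀ κ : ZpExtension ℚ 2, κ.IsCyclotomic →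
      Nat.card {z : W.selmerLayer κ j' // 2 • z = 0} ≤ 2 ^ d)
    (harith : 2 ^ (d + t) * C₂ * ∏ ℓ ∈ P, C ℓ ^ 2 ^ min j' (padicValNat 2 (ℓ ^ 2 - 1) - 3) <
      2 ^ (2 ^ j' - 2 ^ j + a)) : TowerGapAtTwo W := by
  -- the places (exactly as in tower-1 part 8)
  let pl : ℕ → HeightOneSpectrum (𝓞 ℚ) := fun ℓ ↦
    if h : ℓ.Prime then (primesEquiv (R := 𝓞 ℚ)).symm ⟨ℓ, h⟩
      else (primesEquiv (R := 𝓞 ℚ)).symm ⟨2, Nat.prime_two⟩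
  have hpl : ∀ {ℓ : ℕ}, ℓ.Prime → natGenerator (pl ℓ) = ℓ := fun {ℓ} h ↦ by
    simp only [pl, dif_pos h]
    exact congrArg Subtype.val ((primesEquiv (R := 𝓞 ℚ)).apply_symm_apply ⟨ℓ, h⟩)
  have hpl_inj : Set.InjOn pl P := by
    intro ℓ hℓ ℓ' hℓ' h
    have := congrArg natGenerator h
    rwa [hpl (hP ℓ hℓ).1, hpl (hP ℓ' hℓ').1] at this
  let v₂ : HeightOneSpectrum (𝓞 ℚ) := pl 2
  have hv₂ : natGenerator v₂ = 2 := hpl Nat.prime_two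
  have h2v₂ : ((2 : ℕ) : 𝓞 ℚ) ∈ v₂.asIdeal := (natCast_prime_mem_asIdeal_iff v₂ Nat.prime_two).mpr hv₂
  have hv₂_notMem : v₂ ∉ P.image pl := by
    intro h
    obtain ⟨ℓ, hℓ, hℓeq⟩ := Finset.mem_image.mp h
    have := congrArg natGenerator hℓeq
    rw [hpl (hP ℓ hℓ).1, hv₂] at this
    exact (hP ℓ hℓ).2 this
  -- odd places in the image
  have hodd : ∀ {ℓ : ℕ}, ℓ ∈ P → ((2 : ℕ) : 𝓞 ℚ) ∉ (pl ℓ).asIdeal := fun {ℓ} hℓ h ↦ by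
    rw [natCast_prime_mem_asIdeal_iff _ Nat.prime_two, hpl (hP ℓ hℓ).1] at h
    exact (hP ℓ hℓ).2 h
  let S : Finset (HeightOneSpectrum (𝓞 ℚ)) := insert v₂ (P.image pl)
  let Cv : HeightOneSpectrum (𝓞 ℚ) → ℕ := fun v ↦ C (natGenerator v)
  refine towerGapAtTwo_of_layerSelmer_numeric_atTwo_of_torsion W h33g hM hA hB hjj' htor C₂ h2 S ?_ Cv ?_ hlow hup ?_
  · -- `hS`: off `S` every place is odd and good
    intro v hv
    have hgen := prime_natGenerator v
    haveI : Fact (natGenerator v).Prime := ⟨hgen⟩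
    have hvpl : pl (natGenerator v) = v := by
      simp only [pl, dif_pos hgen]
      exact (primesEquiv (R := 𝓞 ℚ)).symm_apply_apply v
    have hne2 : natGenerator v ≠ 2 := by
      intro h
      apply hv
      rw [Finset.mem_insert]
      left
      rw [← hvpl]
      simp only [v₂, h]
    have hnotP : natGenerator v ∉ P := by
      intro h
      exact hv (Finset.mem_insert_of_mem (Finset.mem_image.mpr ⟨_, h, hvpl⟩))
    refine ⟨fun h ↦ hne2 ((natCast_prime_mem_asIdeal_iff v Nat.prime_two).mp h), ?_⟩
    have hndvd : ¬ ((natGenerator v : ℕ) : ℤ) ∣ W.minimalDiscriminantInt :=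
      fun h ↦ hnotP (hΔ _ hgen hne2 h)
    exact (hasGoodReductionAtPrime_iff_hasGoodReductionAt_ringOfIntegers (v := v) W).mp
      (hasGoodReductionAtPrime_of_not_dvd W (natGenerator v) hndvd)
  · -- `hC`: the numeric local constants at the odd places of `S`
    intro v hv h2
    rcases Finset.mem_insert.mp hv with rfl | hv'
    · exact absurd h2v₂ h2
    obtain ⟨ℓ, hℓP, rfl⟩ := Finset.mem_image.mp hv'
    have hℓ := (hP ℓ hℓP).1
    haveI : Fact ℓ.Prime := ⟨hℓ⟩
    have hgen : natGenerator (pl ℓ) = ℓ := hpl hℓ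
    haveI : Fact (Nat.Prime ((primesEquiv (pl ℓ) : Nat.Primes) : ℕ)) := ⟨(primesEquiv (pl ℓ)).2⟩
    have hpe : ((primesEquiv (pl ℓ) : Nat.Primes) : ℕ) = ℓ := hgen
    have hCv : Cv (pl ℓ) = C ℓ := by simp only [Cv, hgen]
    rw [hCv]
    rcases hC ℓ hℓP with h4 | ⟨hm, h2C⟩ | ⟨hm, hord, h1⟩ | ⟨hg, h1⟩
    · exact Or.inl h4
    · refine Or.inr (Or.inl ⟨?_, h2C⟩)
      exact (hasMultiplicativeReductionAtPrime_iff_hasMultiplicativeReductionAt_ringOfIntegers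
        (W := W) (pl ℓ)).mp ((hasMultiplicativeReductionAtPrime_congr W hpe).mpr hm)
    · refine Or.inr (Or.inr (Or.inl ⟨?_, ?_, h1⟩))
      · exact (hasMultiplicativeReductionAtPrime_iff_hasMultiplicativeReductionAt_ringOfIntegers
          (W := W) (pl ℓ)).mp ((hasMultiplicativeReductionAtPrime_congr W hpe).mpr hm)
      · rwa [LocalTorsionMult.ordMinimalDiscriminant_eq_padicValInt W (pl ℓ) hpe]
    · refine Or.inr (Or.inr (Or.inr ⟨?_, h1⟩))
      exact (hasGoodReductionAtPrime_iff_hasGoodReductionAt_ringOfIntegers (v := pl ℓ) W).mp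
        ((hasGoodReductionAtPrime_congr W hpe).mpr (hasGoodReductionAtPrime_of_not_dvd W ℓ hg))
  · -- the arithmetic, re-indexed by primes
    have hprod : ∏ v ∈ S, (if ((2 : ℕ) : 𝓞 ℚ) ∈ v.asIdeal then C₂ else Cv v) ^
        (if ((2 : ℕ) : 𝓞 ℚ) ∈ v.asIdeal then 1
          else 2 ^ min j' (padicValNat 2 (natGenerator v ^ 2 - 1) - 3)) =
        C₂ * ∏ ℓ ∈ P, C ℓ ^ 2 ^ min j' (padicValNat 2 (ℓ ^ 2 - 1) - 3) := by
      rw [Finset.prod_insert hv₂_notMem, if_pos h2v₂, if_pos h2v₂, pow_one,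
        Finset.prod_image hpl_inj]
      congr 1
      refine Finset.prod_congr rfl fun ℓ hℓ ↦ ?_
      rw [if_neg (hodd hℓ), if_neg (hodd hℓ)]
      simp only [Cv, hpl (hP ℓ hℓ).1]
    rw [hprod, ← mul_assoc]
    exact harith

/-- **The GAP certificate, every kernel-side datum decidable, the constant at `2` a DATUM, RATIONAL `2`-TORSION ALLOWED.** As
GEN 4's `MultTowerCert.towerGapAtTwo_of_layerSelmer_cert_atTwo` with `htors` replaced by {`hB`, `htor`} and `2^d` by `2^{d+t}`: the sharp exponent is `2^{min(j', e_ℓ)}` for a certificate `e` with `¬ 2^{e_ℓ+4} ∣ ℓ² − 1`, the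
`C_ℓ = 1` clause is certified by `ℓ^{k_ℓ} ∣ Δ_min`, `ℓ^{k_ℓ+1} ∤ Δ_min`, `2 ∤ k_ℓ`; arithmetic
`2^d · C₂ · ∏_{ℓ ∈ P} C_ℓ^{2^{min(j', e_ℓ)}} < 2^{2^{j'} − 2^j + a}`.
[cite: GreenbergLNM1716, §3 Lemmas 3.3–3.5 (PDF pp. 86–90) and pp. 90–93] [cite: SilvermanAEC2009, VII.1 Prop. 1.3, VII.5.1] -/
theorem towerGapAtTwo_of_layerSelmer_cert_atTwo_of_torsion
    (h33g : lemma33_localTowerKerPrimary_eq_bot_of_good.{0})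
    (hM : lemma33_localTowerKerPrimary_cyclic_of_multiplicative.{0})
    (hA : lemma33_natCard_localTowerKerPrimary_le_four_of_additive.{0})
    (hB : ∀ κ : ZpExtension ℚ 2, κ.IsCyclotomic →
      Finite (FixedPoints.addSubgroup κ.kerSubgroup (geomPrimaryTorsion W 2)))
    {j j' a d t : ℕ} (hjj' : j ≤ j')
    (htor : ∀ κ : ZpExtension ℚ 2, κ.IsCyclotomic →
      Nat.card {m : geomPrimaryTorsion W 2 | ∀ σ ∈ κ.layerSubgroup j, σ • m = m} ≤ 2 ^ t) (C₂ : ℕ)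
    (h2 : ∀ κ : ZpExtension ℚ 2, κ.IsCyclotomic → ∀ v : HeightOneSpectrum (𝓞 ℚ),
      ((2 : ℕ) : 𝓞 ℚ) ∈ v.asIdeal →
        Finite {x : W.localTowerKerPrimary κ (v.adicCompletion ℚ) j' // 2 • x = 0} ∧
          Nat.card {x : W.localTowerKerPrimary κ (v.adicCompletion ℚ) j' // 2 • x = 0} ≤ C₂)
    (P : Finset ℕ) (hP : ∀ ℓ ∈ P, ℓ.Prime ∧ ℓ ≠ 2)
    (hΔ : ∀ ℓ : ℕ, ℓ.Prime → ℓ ≠ 2 → (ℓ : ℤ) ∣ W.minimalDiscriminantInt → ℓ ∈ P)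
    (C e k : ℕ → ℕ) (he : ∀ ℓ ∈ P, ¬ 2 ^ (e ℓ + 4) ∣ ℓ ^ 2 - 1)
    (hC : ∀ (ℓ : ℕ) [Fact ℓ.Prime], ℓ ∈ P →
      4 ≤ C ℓ ∨ (W.HasMultiplicativeReductionAtPrime ℓ ∧ 2 ≤ C ℓ) ∨
        (W.HasMultiplicativeReductionAtPrime ℓ ∧ (ℓ : ℤ) ^ k ℓ ∣ W.minimalDiscriminantInt ∧
          ¬ (ℓ : ℤ) ^ (k ℓ + 1) ∣ W.minimalDiscriminantInt ∧ ¬ 2 ∣ k ℓ ∧ 1 ≤ C ℓ) ∨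
        (¬ (ℓ : ℤ) ∣ W.minimalDiscriminantInt ∧ 1 ≤ C ℓ))
    (hlow : ∀ κ : ZpExtension ℚ 2, κ.IsCyclotomic →
      2 ^ a ≤ Nat.card {z : W.selmerLayer κ j // 2 • z = 0})
    (hup : ∀ κ : ZpExtension ℚ 2, κ.IsCyclotomic →
      Nat.card {z : W.selmerLayer κ j' // 2 • z = 0} ≤ 2 ^ d)
    (harith : 2 ^ (d + t) * C₂ * ∏ ℓ ∈ P, C ℓ ^ 2 ^ min j' (e ℓ) < 2 ^ (2 ^ j' - 2 ^ j + a)) :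
    TowerGapAtTwo W := by
  -- `1 ≤ C ℓ` on `P`
  have hC1 : ∀ ℓ ∈ P, 1 ≤ C ℓ := by
    intro ℓ hℓ
    haveI : Fact ℓ.Prime := ⟨(hP ℓ hℓ).1⟩
    rcases hC ℓ hℓ with h | ⟨-, h⟩ | ⟨-, -, -, -, h⟩ | ⟨-, h⟩ <;> omega
  refine towerGapAtTwo_of_layerSelmer_nat_atTwo_of_torsion W h33g hM hA hB hjj' htor C₂ h2 P hP hΔ C
    (fun ℓ _ hℓ ↦ ?_) hlow hup (lt_of_le_of_lt ?_ harith)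
  · rcases hC ℓ hℓ with h | h | ⟨hm, h1, h2', hodd, hC'⟩ | h
    · exact Or.inl h
    · exact Or.inr (Or.inl h)
    · refine Or.inr (Or.inr (Or.inl ⟨hm, ?_, hC'⟩))
      rwa [padicValInt_eq_of_dvd_of_not_dvd h1 h2']
    · exact Or.inr (Or.inr (Or.inr h))
  · refine Nat.mul_le_mul_left _ (Finset.prod_le_prod (fun ℓ _ ↦ Nat.zero_le _) fun ℓ hℓ ↦ ?_)
    refine Nat.pow_le_pow_right (hC1 ℓ hℓ) (Nat.pow_le_pow_right (by norm_num) ?_)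
    have hℓ2 : ℓ ^ 2 - 1 ≠ 0 := by
      have h3 : 2 ≤ ℓ := (hP ℓ hℓ).1.two_le
      have : 4 ≤ ℓ ^ 2 := by nlinarith
      omega
    exact min_le_min_left _ (padicValNat_sq_sub_one_sub_three_le hℓ2 (he ℓ hℓ))

end Cert

end Summit.BirchSwinnertonDyer.BirchSwinnertonDyer.Theorems.MultTowerTorsion

end
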